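import Summits.ValiantsHypothesis.ValiantsHypothesis.Theorems.DefinabilityGapAdmissibleBlocks
import HarnessLib

/-!
# DefinabilityGap — BLOCK EXCLUSION, stage H1b: two-cycle exclusion, the quadratic count, Frobenius–König

Route `route-ValiantsHypothesis-DefinabilityGap` (DRAFT), read-once leaf F4 / W10 (aside `KIPlantedHittingRO`,
stmt-ValiantsHypothesis-23704), leaf `ZperHits₂(m)`; census cell F4/W10 rung_ladder.next ‖ v35 «δ-parameter»
(decomp-valiant bus, OFFER O-L5-BK; file H1b of the series H1a / H1b / H2 / H3; continues H1a
`DefinabilityGapAdmissibleBlocks`: admissible cells `adm T`, row blocks `R_[a] = rowBlock T a`, column blocks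
`C_[a] = colBlock T a`, balance, surplus, near-perfect matchings).

**THIS FILE** (pure combinatorics of a cell set `T ⊆ m × m` off which some permutation lives; no chains).
* GLUING (`glue_injective`, `exists_gluePerm`): an injective map of a set of columns `S` into a set of rows `Rr`,
  glued with a permutation taking exactly the columns of `S` into `Rr`, is a permutation;
* TWO-CYCLE EXCLUSION (`false_of_two_cycle`, `rect_subset_or`): two distinct blocks are never joined by off-`T`
  cells in both directions — gluing the two near-matchings of H1a with the two joining cells and a base permutation
  (and untwisting by the transposition of the two special rows) gives an avoiding permutation through a joining
  cell, which would tie the blocks; so one of `R_[a] × C_[a']`, `R_[a'] × C_[a]` lies in `T`;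
* THE COUNT (`sq_le_two_mul_card_add`): `m² ≤ 2·|T| + Σ_a |R_[a]|` — the ordered pairs of unlinked rows inject
  twice into `T` by `(a, a') ↦ (a, σ₀⁻¹ a')`; with all blocks of `≤ c` rows, `m² ≤ 2·|T| + c·m`
  (`sq_le_of_card_rowBlock_le`); tight: `m = 4`, `c = 2`, `T = {0,1} × {2,3}`;
* FROBENIUS–KÖNIG (`exists_rectangle_of_avoid_eq_empty`, the direction used, from Hall): if NO permutation avoids
  `T`, then `T ⊇ R × C` with `|R| + |C| ≥ m + 1`.

HONEST PLACEMENT. KNOWN mathematics: two-cycle exclusion is the acyclicity of the Dulmage–Mendelsohn / Brualdi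
block-triangular canonical form [cite: BrualdiRyser1991, Thm. 4.2.6], proved here directly from Hall's theorem
(Mathlib `Finset.all_card_le_biUnion_card_iff_exists_injective`); Frobenius–König [cite: BrualdiRyser1991,
Thm. 1.2.1]. Kernel-new bookkeeping only; closes NO item; 0 S-currency; rung 0; VP ≠ VNP untouched. No facts, no
Prop-valued definitions, no placeholders, no data definitions.
-/

set_option linter.dupNamespace false

open Finset
open Summit.ValiantsHypothesis.ValiantsHypothesis.Theorems.DefinabilityGapZeroPatternPermanent
open Summit.ValiantsHypothesis.ValiantsHypothesis.Theorems.DefinabilityGapAdmissibleBlocks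

namespace Summit.ValiantsHypothesis.ValiantsHypothesis.Theorems.DefinabilityGapBlockExclusion

noncomputable section

variable {m : ℕ}

/-! ## 1. Gluing and two-cycle exclusion -/

/-- GLUING: an injective map of a set of columns `S` into a set of rows `Rr`, glued with a permutation taking
exactly the columns of `S` to `Rr`, is injective. [folklore] -/
theorem glue_injective {S Rr : Finset (Fin m)} (u : ↥S → Fin m) (hu : Function.Injective u)
    (huR : ∀ y, u y ∈ Rr) (β : Equiv.Perm (Fin m)) (hβ : ∀ i, β i ∈ Rr ↔ i ∈ S) :
    Function.Injective fun i => if h : i ∈ S then u ⟨i, h⟩ else β i := by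
  intro i j hij
  by_cases hi : i ∈ S <;> by_cases hj : j ∈ S
  · simp only [dif_pos hi, dif_pos hj] at hij
    exact congrArg Subtype.val (hu hij)
  · simp only [dif_pos hi, dif_neg hj] at hij
    exact (hj ((hβ j).1 (hij ▸ huR ⟨i, hi⟩))).elim
  · simp only [dif_neg hi, dif_pos hj] at hij
    exact (hi ((hβ i).1 (hij ▸ huR ⟨j, hj⟩))).elim
  · simp only [dif_neg hi, dif_neg hj] at hij
    exact β.injective hij

/-- The GLUED PERMUTATION of `glue_injective` exists. [folklore] -/
theorem exists_gluePerm {S Rr : Finset (Fin m)} (u : ↥S → Fin m) (hu : Function.Injective u)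
    (huR : ∀ y, u y ∈ Rr) (β : Equiv.Perm (Fin m)) (hβ : ∀ i, β i ∈ Rr ↔ i ∈ S) :
    ∃ π : Equiv.Perm (Fin m), (∀ i (h : i ∈ S), π i = u ⟨i, h⟩) ∧ ∀ i, i ∉ S → π i = β i := by
  refine ⟨Equiv.ofBijective _ (Finite.injective_iff_bijective.1 (glue_injective u hu huR β hβ)),
    fun i h => ?_, fun i h => ?_⟩
  · simp [h]
  · simp [h]

/-- BLOCK MAPS: an injective map of the whole column block into the row block, off `T` except at one prescribed
column `b₁` sent to a prescribed row `z` (any `z` off `R_[a] ∖ {a₁}`), all other values off the row `a₁`.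
[this file] -/
theorem exists_blockMap {T : Finset (Fin m × Fin m)} (h0 : (avoid T).Nonempty) {a a₁ b₁ : Fin m}
    (ha₁ : a₁ ∈ rowBlock T a) (hb₁ : b₁ ∈ colBlock T a) {z : Fin m} (hz : z ∉ (rowBlock T a).erase a₁) :
    ∃ f : ↥(colBlock T a) → Fin m, Function.Injective f ∧ f ⟨b₁, hb₁⟩ = z ∧
      ∀ y : ↥(colBlock T a),
        (y : Fin m) ≠ b₁ → f y ∈ (rowBlock T a).erase a₁ ∧ (f y, (y : Fin m)) ∉ T := by
  obtain ⟨f₀, hf₀, hf₀t⟩ := exists_nearMatching h0 ha₁ hb₁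
  refine ⟨fun y => if hy : (y : Fin m) = b₁ then z else f₀ ⟨y, mem_erase.2 ⟨hy, y.2⟩⟩, ?_,
    by simp, fun y hy => ?_⟩
  · intro y y' h
    by_cases hy : (y : Fin m) = b₁ <;> by_cases hy' : (y' : Fin m) = b₁
    · exact Subtype.ext (hy.trans hy'.symm)
    · simp only [dif_pos hy, dif_neg hy'] at h
      have h1 := (hf₀t ⟨y', mem_erase.2 ⟨hy', y'.2⟩⟩).1
      rw [← h] at h1; exact (hz h1).elim
    · simp only [dif_neg hy, dif_pos hy'] at h
      have h1 := (hf₀t ⟨y, mem_erase.2 ⟨hy, y.2⟩⟩).1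
      rw [h] at h1; exact (hz h1).elim
    · simp only [dif_neg hy, dif_neg hy'] at h
      have hv := congrArg Subtype.val (hf₀ h)
      exact Subtype.ext hv
  · simp only [dif_neg hy]
    exact hf₀t _

/-- TWO-CYCLE EXCLUSION: two distinct blocks are never joined by off-`T` cells in both directions (else a glued
avoiding permutation would pass through a joining cell and tie the blocks). [cite: BrualdiRyser1991, Thm. 4.2.6] -/
theorem false_of_two_cycle {T : Finset (Fin m × Fin m)} (h0 : (avoid T).Nonempty) {a a' b b' : Fin m}
    (hna : a' ∉ rowBlock T a) (hb : b ∈ colBlock T a') (hb' : b' ∈ colBlock T a) (he : (a, b) ∉ T)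
    (he' : (a', b') ∉ T) : False := by
  obtain ⟨σ₀, hσ₀⟩ := id h0
  have hRR : Disjoint (rowBlock T a) (rowBlock T a') := disjoint_rowBlock hna
  have haR : a ∈ rowBlock T a := self_mem_rowBlock T a
  have ha'R : a' ∈ rowBlock T a' := self_mem_rowBlock T a'
  have haR' : a ∉ rowBlock T a' := fun h => disjoint_left.1 hRR haR h
  -- block maps: `C_[a] → R_[a]` with `b' ↦ a` and `C_[a'] → R_[a']` with `b ↦ a'` (swapped targets!)
  obtain ⟨f, hf, hfb, hft⟩ := exists_blockMap h0 haR hb' (z := a) (fun h => (mem_erase.1 h).1 rfl)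
  obtain ⟨f', hf', hf'b, hf't⟩ := exists_blockMap h0 ha'R hb (z := a') (fun h => (mem_erase.1 h).1 rfl)
  have hfR : ∀ y, f y ∈ rowBlock T a := fun y => by
    by_cases hy : (y : Fin m) = b'
    · have : y = ⟨b', hb'⟩ := Subtype.ext hy
      rw [this, hfb]; exact haR
    · exact mem_of_mem_erase (hft y hy).1
  have hf'R : ∀ y, f' y ∈ rowBlock T a' := fun y => by
    by_cases hy : (y : Fin m) = b
    · have : y = ⟨b, hb⟩ := Subtype.ext hy
      rw [this, hf'b]; exact ha'R
    · exact mem_of_mem_erase (hf't y hy).1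
  -- glue: `f'` with `σ₀`, then `f` with that
  have hβ₁ : ∀ i, σ₀ i ∈ rowBlock T a' ↔ i ∈ colBlock T a' :=
    fun i => (mem_colBlock_iff_apply_mem_rowBlock hσ₀).symm
  obtain ⟨π₂, hπ₂S, hπ₂N⟩ := exists_gluePerm f' hf' hf'R σ₀ hβ₁
  have hβ₂ : ∀ i, π₂ i ∈ rowBlock T a ↔ i ∈ colBlock T a := by
    intro i
    by_cases hi : i ∈ colBlock T a'
    · rw [hπ₂S i hi]
      exact ⟨fun h => (disjoint_left.1 hRR h (hf'R _)).elim,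
        fun h => (disjoint_left.1 (disjoint_colBlock hna) h hi).elim⟩
    · rw [hπ₂N i hi]
      exact (mem_colBlock_iff_apply_mem_rowBlock hσ₀).symm
  obtain ⟨π, hπS, hπN⟩ := exists_gluePerm f hf hfR π₂ hβ₂
  -- the permutation `swap a a' ∘ π` avoids `T` and passes through `(a', b')`
  have hτ_avoid : π.trans (Equiv.swap a a') ∈ avoid T := by
    refine mem_avoid.2 fun i => ?_
    rw [Equiv.trans_apply]
    by_cases hi : i ∈ colBlock T a
    · rw [hπS i hi]
      by_cases hib : i = b'
      · subst hib
        rw [hfb, Equiv.swap_apply_left]; exact he'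
      · obtain ⟨h1, h2⟩ := hft ⟨i, hi⟩ hib
        have hne₂ : f ⟨i, hi⟩ ≠ a' := fun h => hna (h ▸ mem_of_mem_erase h1)
        rw [Equiv.swap_apply_of_ne_of_ne (mem_erase.1 h1).1 hne₂]
        exact h2
    · rw [hπN i hi]
      by_cases hi' : i ∈ colBlock T a'
      · rw [hπ₂S i hi']
        by_cases hib : i = b
        · subst hib
          rw [hf'b, Equiv.swap_apply_right]; exact he
        · obtain ⟨h1, h2⟩ := hf't ⟨i, hi'⟩ hib
          have hne₁ : f' ⟨i, hi'⟩ ≠ a := fun h => haR' (h ▸ mem_of_mem_erase h1)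
          rw [Equiv.swap_apply_of_ne_of_ne hne₁ (mem_erase.1 h1).1]
          exact h2
      · rw [hπ₂N i hi']
        have hne₁ : σ₀ i ≠ a := fun h => hi ((mem_colBlock_iff_apply_mem_rowBlock hσ₀).2 (h ▸ haR))
        have hne₂ : σ₀ i ≠ a' := fun h => hi' ((mem_colBlock_iff_apply_mem_rowBlock hσ₀).2 (h ▸ ha'R))
        rw [Equiv.swap_apply_of_ne_of_ne hne₁ hne₂]
        exact (mem_avoid.1 hσ₀) i
  have hτb' : π.trans (Equiv.swap a a') b' = a' := by
    rw [Equiv.trans_apply, hπS b' hb', hfb, Equiv.swap_apply_left]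
  -- so `(a', b')` is admissible: `b'` is a block column of `a'` as well as of `a`
  have hadm : (a', b') ∈ adm T := mk_mem_adm.2 ⟨_, hτ_avoid, hτb'⟩
  exact hna (mem_rowBlock_of_mem_colBlock hb' (mem_colBlock.2 ⟨a', ha'R, hadm⟩))

/-- RECTANGLES: for two distinct blocks one of `R_[a] × C_[a']`, `R_[a'] × C_[a]` lies inside `T`.
[cite: BrualdiRyser1991, Thm. 4.2.6] -/
theorem rect_subset_or {T : Finset (Fin m × Fin m)} (h0 : (avoid T).Nonempty) {a a' : Fin m}
    (hna : a' ∉ rowBlock T a) :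
    rowBlock T a ×ˢ colBlock T a' ⊆ T ∨ rowBlock T a' ×ˢ colBlock T a ⊆ T := by
  by_contra h
  rw [not_or] at h
  obtain ⟨⟨x, y⟩, he, heT⟩ := not_subset.1 h.1
  obtain ⟨⟨x', y'⟩, he', he'T⟩ := not_subset.1 h.2
  obtain ⟨hx, hy⟩ := mem_product.1 he
  obtain ⟨hx', hy'⟩ := mem_product.1 he'
  refine false_of_two_cycle h0 (a := x) (a' := x') (b := y) (b' := y') (fun hmem => hna ?_)
    (by rw [colBlock_eq_of_mem hx']; exact hy) (by rw [colBlock_eq_of_mem hx]; exact hy') heT he'T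
  have e1 := rowBlock_eq_of_mem hmem
  rw [rowBlock_eq_of_mem hx] at e1
  have : a' ∈ rowBlock T x' := by rw [rowBlock_eq_of_mem hx']; exact self_mem_rowBlock T a'
  rwa [e1] at this

/-! ## 2. The quadratic count; Frobenius–König -/

/-- **THE QUADRATIC COUNT** `m² ≤ 2·|T| + Σ_a |R_[a]|` (ordered pairs of unlinked rows inject twice into `T`
via `(a, a') ↦ (a, σ₀⁻¹ a')`). [this file] -/
theorem sq_le_two_mul_card_add (T : Finset (Fin m × Fin m)) (h0 : (avoid T).Nonempty) :
    m * m ≤ 2 * T.card + ∑ a, (rowBlock T a).card := by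
  obtain ⟨σ₀, hσ₀⟩ := id h0
  have hLU : ((univ : Finset (Fin m × Fin m)).filter fun p => p.2 ∈ rowBlock T p.1).card +
      ((univ : Finset (Fin m × Fin m)).filter fun p => p.2 ∉ rowBlock T p.1).card = m * m := by
    rw [card_filter_add_card_filter_not, card_univ, Fintype.card_prod, Fintype.card_fin]
  -- linked pairs
  have hL : ((univ : Finset (Fin m × Fin m)).filter fun p => p.2 ∈ rowBlock T p.1).card =
      ∑ a, (rowBlock T a).card := by
    simp only [card_filter, Fintype.sum_prod_type]
    simp only [sum_boole, Nat.cast_id, filter_univ_mem]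
  -- unlinked pairs
  have hφ : Function.Injective fun p : Fin m × Fin m => (p.1, σ₀.symm p.2) := by
    rintro ⟨p₁, p₂⟩ ⟨q₁, q₂⟩ h
    simp only [Prod.mk.injEq, EmbeddingLike.apply_eq_iff_eq] at h
    rw [h.1, h.2]
  have hψ : Function.Injective fun p : Fin m × Fin m => (p.2, σ₀.symm p.1) := by
    rintro ⟨p₁, p₂⟩ ⟨q₁, q₂⟩ h
    simp only [Prod.mk.injEq, EmbeddingLike.apply_eq_iff_eq] at h
    rw [h.1, h.2]
  have hcover : ((univ : Finset (Fin m × Fin m)).filter fun p => p.2 ∉ rowBlock T p.1) ⊆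
      (univ.filter fun p : Fin m × Fin m => (p.1, σ₀.symm p.2) ∈ T) ∪
        univ.filter fun p : Fin m × Fin m => (p.2, σ₀.symm p.1) ∈ T := by
    intro p hp
    have hna : p.2 ∉ rowBlock T p.1 := (mem_filter.1 hp).2
    rw [mem_union, mem_filter, mem_filter]
    rcases rect_subset_or h0 hna with h | h
    · exact Or.inl ⟨mem_univ _, h (mem_product.2
        ⟨self_mem_rowBlock T p.1, symm_apply_mem_colBlock hσ₀ (self_mem_rowBlock T p.2)⟩)⟩
    · exact Or.inr ⟨mem_univ _, h (mem_product.2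
        ⟨self_mem_rowBlock T p.2, symm_apply_mem_colBlock hσ₀ (self_mem_rowBlock T p.1)⟩)⟩
  have h1 : (univ.filter fun p : Fin m × Fin m => (p.1, σ₀.symm p.2) ∈ T).card ≤ T.card := by
    rw [← card_image_of_injective (univ.filter fun p : Fin m × Fin m => (p.1, σ₀.symm p.2) ∈ T) hφ]
    exact card_le_card fun x hx => by
      obtain ⟨p, hp, rfl⟩ := mem_image.1 hx
      exact (mem_filter.1 hp).2
  have h2 : (univ.filter fun p : Fin m × Fin m => (p.2, σ₀.symm p.1) ∈ T).card ≤ T.card := by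
    rw [← card_image_of_injective (univ.filter fun p : Fin m × Fin m => (p.2, σ₀.symm p.1) ∈ T) hψ]
    exact card_le_card fun x hx => by
      obtain ⟨p, hp, rfl⟩ := mem_image.1 hx
      exact (mem_filter.1 hp).2
  have hU := (card_le_card hcover).trans (card_union_le _ _)
  omega

/-- Hence, when every block has at most `c` rows, `m² ≤ 2·|T| + c·m`. [this file] -/
theorem sq_le_of_card_rowBlock_le (T : Finset (Fin m × Fin m)) (h0 : (avoid T).Nonempty) {c : ℕ}
    (hc : ∀ a, (rowBlock T a).card ≤ c) : m * m ≤ 2 * T.card + c * m := by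
  have h := sum_le_sum fun a (_ : a ∈ (univ : Finset (Fin m))) => hc a
  rw [sum_const, card_univ, Fintype.card_fin, smul_eq_mul] at h
  have := sq_le_two_mul_card_add T h0
  rw [mul_comm c m]; omega

/-- FROBENIUS–KÖNIG (the direction used; Hall): if no permutation avoids `T`, then `T` contains a rectangle
`R × C` with `|R| + |C| ≥ m + 1`. [cite: BrualdiRyser1991, Thm. 1.2.1] -/
theorem exists_rectangle_of_avoid_eq_empty {T : Finset (Fin m × Fin m)} (h : avoid T = ∅) :
    ∃ R C : Finset (Fin m), m + 1 ≤ R.card + C.card ∧ R ×ˢ C ⊆ T := by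
  by_contra hno
  -- Hall's condition for the rows against the off-`T` columns
  have hall : ∀ s : Finset (Fin m), s.card ≤ (s.biUnion fun a => univ.filter fun b => (a, b) ∉ T).card := by
    intro s
    by_contra hs
    refine hno ⟨s, (s.biUnion fun a => univ.filter fun b => (a, b) ∉ T)ᶜ, ?_, fun x hx => ?_⟩
    · have := (s.biUnion fun a => univ.filter fun b => (a, b) ∉ T).card_le_univ
      rw [Fintype.card_fin] at this
      rw [card_compl, Fintype.card_fin]; omega
    · obtain ⟨hx1, hx2⟩ := mem_product.1 hx
      rw [mem_compl, mem_biUnion] at hx2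
      by_contra hxT
      exact hx2 ⟨x.1, hx1, mem_filter.2 ⟨mem_univ _, hxT⟩⟩
  obtain ⟨f, hf, hft⟩ := (all_card_le_biUnion_card_iff_exists_injective _).1 hall
  have hbij := Finite.injective_iff_bijective.1 hf
  have hρ : (Equiv.ofBijective f hbij).symm ∈ avoid T := by
    refine mem_avoid.2 fun i => ?_
    have h1 := (mem_filter.1 (hft ((Equiv.ofBijective f hbij).symm i))).2
    rwa [Equiv.ofBijective_apply_symm_apply f hbij i] at h1
  rw [h] at hρ
  exact notMem_empty _ hρ

end

end Summit.ValiantsHypothesis.ValiantsHypothesis.Theorems.DefinabilityGapBlockExclusion
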